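import Summits.QuantumFields.BalabanUV.Beta.EriceRemainderEnclosureHistoryAutonomyComparisonDefectOscillationRatio
import Summits.QuantumFields.BalabanUV.Beta.EriceRemainderEnclosureHistoryAutonomyComparisonDefectAbove

/-!
# EriceRemainderEnclosureHistoryAutonomyComparisonDefectEnclosure — (E140f) **ENCLOSURE OF AN ARBITRARY `ε`-PERTURBATION OF A STRUCTURED MEMORY BETWEEN THE SHIFTED
# STRUCTURED FLOWS, UP TO SCALE-UNIFORM FACTORS.**  `B` isotone on `]0,γ]^ℕ` with zeroth moment `M`, floor `b > 0`, `B ≤ β̄`, and a level-Lipschitz age profile `Λ ≥ 0`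
# (moment `θ = Σ_{k<K} k·Λ_k < 1`) on the box graded by `b − ε`; `B′` ANY functional with **`|B′ − B| ≤ ε`** on the box (`0 ≤ ε < b`; NO sign, NO modulus, NO monotonicity of
# the remainder `B′ − B`).  Let `h₋, h₊` be box solutions of the SHIFTED structured memories `B − ε`, `B + ε` and `h′` one of `B′`, all from one pin.  Then with
#   **`κ := 2θε ∕ ((1−θ)(b−ε))`**  (and `κ < 1` for the upper half):   **`h₊_j ∕ √(1+κ) ≤ h′_j ≤ h₋_j ∕ √(1−κ)`  at EVERY scale `j`**  (`enclosure`).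
# The remainder is read as a sign-free excess `B′ − (B−ε) ∈ [0, 2ε]` over the lower shifted memory ((E140d) `two_sided_ratio`) and as a sign-free deficit
# `(B+ε) − B′ ∈ [0, 2ε]` under the upper one ((E140e) `coupling_ratio_ge`); both have oscillation `2ε`, and the contraction of (E140c) turns it into the fixed fraction `κ`
# of the levels.  `θ = 0` (Markov base): `κ = 0`, the classical enclosure `h₊ ≤ h′ ≤ h₋`.  This is the column's ENCLOSURE statement for SIGN-FREE remainders — what item (β)
# of `HOME/b2b-balaban-beta-d4-p2/g107/README.md` §4 asked for: no sign is needed for enclosure up to the factor `(1∓κ)^{∓1∕2}`, and (E140b) shows a sign (or the two-sided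
# law `θ·ε_hi ≤ ε_lo`) IS needed for enclosure proper.

Cell `pub-balaban`, β-function sub-cell, BINDER row D4 «RemainderConst leaves for Bałaban's split» (`HOME/BINDER-OWNERS.md`; owner lineage `b2b-balaban-beta-an4`;
this file by co-owner #2 lineage `b2b-balaban-beta-d4-p2`, generation 108), β-FLOW TEAM duty (1), FREEZE (0) honoured (def-free: the shifted memories are the displayed
lambda terms `fun u => B u ∓ ε`; (E140d) `two_sided_ratio`, (E140e) `coupling_ratio_ge` BY NAME; nothing restated).

HONEST FRAMING (page 1, verbatim and binding).  *"Discharging BetaPertH makes Bałaban's UV stability UNCONDITIONAL — a real constructive-QFT result; it is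
NOT the continuum limit and NOT the Clay problem."*  THIS FILE DISCHARGES NOTHING OF THE KIND.  Elementary real analysis about ABSTRACT functionals on a box
]0,γ]^ℕ (node U2's `MemFlow` ∕ `SeqBox`) — hypotheses of a census, not facts: whether Bałaban's (1.22) limit functional splits as a structured (isotone, level-Lipschitz,
`θ < 1`) part plus an `ε`-remainder is NOT PRINTED ([I] p. 298; GAPS G-t4-U2-1∕-2) and NOT asserted.  Row D4 class UNCHANGED (critical-path width 0; instance 0∕1;
D4 DISCHARGE NO DATE).  NOT B12 Thm 2, NOT BetaPertH, NOT continuum YM, NOT Clay.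

WHAT IS PROVED ([folklore]; 0 `def`, 0 sorry).  §1 `shift_mono`, `shift_zm`, `shift_profile` (the shifted memories inherit the structure).  §2 **`enclosure_upper`**,
**`enclosure_lower`**, **`enclosure`**.
-/

noncomputable section
open Finset Set

namespace Summit.QuantumFields.BalabanUV.Beta.EriceRemainderEnclosureHistoryAutonomyComparisonDefectEnclosure

open Literature.MathematicalPhysics.QuantumFieldTheory.Balaban1983to89
open Literature.MathematicalPhysics.QuantumFieldTheory.Balaban1983to89.T4BetaStationary
open Literature.MathematicalPhysics.QuantumFieldTheory.Balaban1983to89.T4BetaFlowWellPosed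
open Summit.QuantumFields.BalabanUV.Beta.EriceRemainderEnclosureHistoryAutonomyComparisonDefectOscillationRatio (two_sided_ratio)
open Summit.QuantumFields.BalabanUV.Beta.EriceRemainderEnclosureHistoryAutonomyComparisonDefectAbove (coupling_ratio_ge)

variable {B B' : (ℕ → ℝ) → ℝ} {M γ b : ℝ} {h' hlo hup : ℕ → ℝ}

/-! ## §1 The shifted memories `B + c` inherit isotonicity, the zeroth moment and the level profile -/

/-- A constant shift keeps isotonicity. [folklore] -/
theorem shift_mono (c : ℝ) (hmono : ∀ u v : ℕ → ℝ, SeqBox γ u → SeqBox γ v → (∀ i, u i ≤ v i) → B u ≤ B v) :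
    ∀ u v : ℕ → ℝ, SeqBox γ u → SeqBox γ v → (∀ i, u i ≤ v i) → (fun w => B w + c) u ≤ (fun w => B w + c) v :=
  fun u v hu hv huv => by show B u + c ≤ B v + c; linarith [hmono u v hu hv huv]

/-- A constant shift keeps the zeroth moment. [folklore] -/
theorem shift_zm (c : ℝ) (hB : ∀ u u' : ℕ → ℝ, SeqBox γ u → SeqBox γ u' → ∀ D : ℝ, (∀ j, |u j - u' j| ≤ D) → |B u - B u'| ≤ M * D) :
    ∀ u u' : ℕ → ℝ, SeqBox γ u → SeqBox γ u' → ∀ D : ℝ, (∀ j, |u j - u' j| ≤ D) →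
      |(fun w => B w + c) u - (fun w => B w + c) u'| ≤ M * D :=
  fun u u' hu hu' D hD => by
    show |B u + c - (B u' + c)| ≤ M * D
    rw [show B u + c - (B u' + c) = B u - B u' by ring]
    exact hB u u' hu hu' D hD

/-- A constant shift keeps the level-Lipschitz age profile (on any graded box). [folklore] -/
theorem shift_profile (c : ℝ) {Λ : ℕ → ℝ} {K : ℕ} {b₀ : ℝ}
    (hLip : ∀ u v : ℕ → ℝ, SeqBox γ u → SeqBox γ v → (∀ k : ℕ, 1 / γ ^ 2 + ((k : ℝ) + 1) * b₀ ≤ 1 / u k ^ 2) →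
      (∀ k : ℕ, 1 / γ ^ 2 + ((k : ℝ) + 1) * b₀ ≤ 1 / v k ^ 2) → B u - B v ≤ ∑ k ∈ range K, Λ k * max (1 / v k ^ 2 - 1 / u k ^ 2) 0) :
    ∀ u v : ℕ → ℝ, SeqBox γ u → SeqBox γ v → (∀ k : ℕ, 1 / γ ^ 2 + ((k : ℝ) + 1) * b₀ ≤ 1 / u k ^ 2) →
      (∀ k : ℕ, 1 / γ ^ 2 + ((k : ℝ) + 1) * b₀ ≤ 1 / v k ^ 2) →
      (fun w => B w + c) u - (fun w => B w + c) v ≤ ∑ k ∈ range K, Λ k * max (1 / v k ^ 2 - 1 / u k ^ 2) 0 :=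
  fun u v hu hv hgu hgv => by
    show B u + c - (B v + c) ≤ _
    rw [show B u + c - (B v + c) = B u - B v by ring]
    exact hLip u v hu hv hgu hgv

/-! ## §2 The enclosure -/

/-- **UPPER HALF: `h′_j ≤ h₋_j ∕ √(1−κ)`**, `κ = 2θε∕((1−θ)(b−ε)) < 1`, `h₋` a box solution of the LOWER shifted memory `B − ε` from the same pin — (E140d)
`two_sided_ratio` for the sign-free excess `B′ − (B − ε) ∈ [0, 2ε]`. [folklore] -/
theorem enclosure_upper {Λ : ℕ → ℝ} {K : ℕ} {βb p ε : ℝ}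
    (hmono : ∀ u v : ℕ → ℝ, SeqBox γ u → SeqBox γ v → (∀ i, u i ≤ v i) → B u ≤ B v)
    (hB : ∀ u u' : ℕ → ℝ, SeqBox γ u → SeqBox γ u' → ∀ D : ℝ, (∀ j, |u j - u' j| ≤ D) → |B u - B u'| ≤ M * D) (hM : 0 ≤ M)
    (hεb : ε < b) (hlow : ∀ u, SeqBox γ u → b ≤ B u) (hbdd : ∀ u, SeqBox γ u → B u ≤ βb)
    (hΛ : ∀ k, 0 ≤ Λ k) (hθ : ∑ k ∈ range K, (k : ℝ) * Λ k < 1)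
    (hκ : (∑ k ∈ range K, (k : ℝ) * Λ k) * (2 * ε) / (1 - ∑ k ∈ range K, (k : ℝ) * Λ k) < b - ε)
    (hLip : ∀ u v : ℕ → ℝ, SeqBox γ u → SeqBox γ v → (∀ k : ℕ, 1 / γ ^ 2 + ((k : ℝ) + 1) * (b - ε) ≤ 1 / u k ^ 2) →
      (∀ k : ℕ, 1 / γ ^ 2 + ((k : ℝ) + 1) * (b - ε) ≤ 1 / v k ^ 2) → B u - B v ≤ ∑ k ∈ range K, Λ k * max (1 / v k ^ 2 - 1 / u k ^ 2) 0)
    (hpert : ∀ u, SeqBox γ u → |B' u - B u| ≤ ε)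
    (hp : 0 < p) (hpγ : p ≤ γ) (hhlo : SeqBox γ hlo) (hflo : MemFlow (fun w => B w + -ε) p hlo)
    (hh' : SeqBox γ h') (hf' : MemFlow B' p h') (j : ℕ) :
    h' j ≤ hlo j / Real.sqrt (1 - (∑ k ∈ range K, (k : ℝ) * Λ k) * (2 * ε) / (1 - ∑ k ∈ range K, (k : ℝ) * Λ k) / (b - ε)) := by
  have hb0 : 0 < b - ε := by linarith
  have hlo0 : ∀ u, SeqBox γ u → b - ε ≤ (fun w => B w + -ε) u := fun u hu => by
    show b - ε ≤ B u + -ε; linarith [hlow u hu]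
  have htwo : ∀ u, SeqBox γ u → 0 ≤ B' u - (fun w => B w + -ε) u ∧ B' u - (fun w => B w + -ε) u ≤ 2 * ε := fun u hu => by
    have h1 := abs_le.mp (hpert u hu)
    constructor
    · show 0 ≤ B' u - (B u + -ε); linarith [h1.1]
    · show B' u - (B u + -ε) ≤ 2 * ε; linarith [h1.2]
  have hbdd' : ∀ u, SeqBox γ u → B' u ≤ βb + ε := fun u hu => by
    linarith [(abs_le.mp (hpert u hu)).2, hbdd u hu]
  have hκ' : (∑ k ∈ range K, (k : ℝ) * Λ k) * (2 * ε - 0) / (1 - ∑ k ∈ range K, (k : ℝ) * Λ k) < b - ε := by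
    rw [sub_zero]; exact hκ
  have := two_sided_ratio (B := fun w => B w + -ε) (B' := B') (shift_mono (-ε) hmono) (shift_zm (-ε) hB) hM hb0 hlo0 hΛ hθ le_rfl hκ'
    (shift_profile (-ε) hLip) htwo hbdd' hp hpγ hhlo hflo hh' hf' j
  rwa [sub_zero] at this

/-- **LOWER HALF: `h₊_j ∕ √(1+κ) ≤ h′_j`**, `κ = 2θε∕((1−θ)(b−ε))`, `h₊` a box solution of the UPPER shifted memory `B + ε` from the same pin — (E140e) `coupling_ratio_ge`
for the sign-free deficit `(B + ε) − B′ ∈ [0, 2ε]` (common floor `b − ε`). [folklore] -/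
theorem enclosure_lower {Λ : ℕ → ℝ} {K : ℕ} {βb p ε : ℝ}
    (hmono : ∀ u v : ℕ → ℝ, SeqBox γ u → SeqBox γ v → (∀ i, u i ≤ v i) → B u ≤ B v)
    (hB : ∀ u u' : ℕ → ℝ, SeqBox γ u → SeqBox γ u' → ∀ D : ℝ, (∀ j, |u j - u' j| ≤ D) → |B u - B u'| ≤ M * D) (hM : 0 ≤ M)
    (hε : 0 ≤ ε) (hεb : ε < b) (hlow : ∀ u, SeqBox γ u → b ≤ B u) (hbdd : ∀ u, SeqBox γ u → B u ≤ βb)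
    (hΛ : ∀ k, 0 ≤ Λ k) (hθ : ∑ k ∈ range K, (k : ℝ) * Λ k < 1)
    (hLip : ∀ u v : ℕ → ℝ, SeqBox γ u → SeqBox γ v → (∀ k : ℕ, 1 / γ ^ 2 + ((k : ℝ) + 1) * (b - ε) ≤ 1 / u k ^ 2) →
      (∀ k : ℕ, 1 / γ ^ 2 + ((k : ℝ) + 1) * (b - ε) ≤ 1 / v k ^ 2) → B u - B v ≤ ∑ k ∈ range K, Λ k * max (1 / v k ^ 2 - 1 / u k ^ 2) 0)
    (hpert : ∀ u, SeqBox γ u → |B' u - B u| ≤ ε)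
    (hp : 0 < p) (hpγ : p ≤ γ) (hhup : SeqBox γ hup) (hfup : MemFlow (fun w => B w + ε) p hup)
    (hh' : SeqBox γ h') (hf' : MemFlow B' p h') (j : ℕ) :
    hup j / Real.sqrt (1 + (∑ k ∈ range K, (k : ℝ) * Λ k) * (2 * ε) / (1 - ∑ k ∈ range K, (k : ℝ) * Λ k) / (b - ε)) ≤ h' j := by
  have hb0 : 0 < b - ε := by linarith
  have hθ0 : 0 ≤ ∑ k ∈ range K, (k : ℝ) * Λ k := sum_nonneg fun k _ => mul_nonneg (Nat.cast_nonneg k) (hΛ k)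
  have hθτ : (1 + (0 : ℝ)) * ∑ k ∈ range K, (k : ℝ) * Λ k ≤ 1 := by linarith
  have hlo' : ∀ u, SeqBox γ u → b - ε ≤ B' u := fun u hu => by
    linarith [(abs_le.mp (hpert u hu)).1, hlow u hu]
  have hle : ∀ u, SeqBox γ u → B' u ≤ (fun w => B w + ε) u := fun u hu => by
    show B' u ≤ B u + ε; linarith [(abs_le.mp (hpert u hu)).2]
  have hbdd' : ∀ u, SeqBox γ u → (fun w => B w + ε) u ≤ βb + ε := fun u hu => by
    show B u + ε ≤ βb + ε; linarith [hbdd u hu]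
  have hDdef : ∀ u v : ℕ → ℝ, SeqBox γ u → SeqBox γ v → (∀ i, u i ≤ v i) →
      (fun w => B w + ε) u - B' u ≤ (1 + (0 : ℝ)) * ((fun w => B w + ε) v - B' v) + 2 * ε := fun u v hu hv _ => by
    show B u + ε - B' u ≤ (1 + 0) * (B v + ε - B' v) + 2 * ε
    linarith [(abs_le.mp (hpert u hu)).1, (abs_le.mp (hpert v hv)).2]
  have hε2 : 0 ≤ 2 * ε := by linarith
  exact coupling_ratio_ge (B := fun w => B w + ε) (B' := B') (shift_mono ε hmono) (shift_zm ε hB) hM hb0 hlo' hle hbdd' hΛ hθ le_rfl hθτ hε2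
    (shift_profile ε hLip) hDdef hp hpγ hhup hfup hh' hf' j

/-- **THE ENCLOSURE.**  `B`: isotone on the box `]0,γ]^ℕ`, zeroth moment `M`, floor `b > 0`, `B ≤ β̄`, level-Lipschitz age profile `Λ ≥ 0` on the box graded by `b − ε`
(`B u − B v ≤ Σ_{k<K} Λ_k·(1∕v_k² − 1∕u_k²)⁺` when the age-`k` levels are `≥ 1∕γ² + (k+1)(b−ε)`), `θ := Σ_{k<K} k·Λ_k < 1`.  `B′`: ANY functional with **`|B′ u − B u| ≤ ε`** on
the box, `0 ≤ ε < b` (so `b > 0`) — a SIGN-FREE remainder.  `h₋, h₊, h′`: ANY box solutions of `B − ε`, `B + ε`, `B′` from one pin `p`.  If **`κ := 2θε∕((1−θ)(b−ε)) < 1`** then at every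
scale `j`:   **`h₊_j ∕ √(1+κ) ≤ h′_j ≤ h₋_j ∕ √(1−κ)`**.  For a Markov base (`θ = 0`) `κ = 0`: the classical enclosure between the shifted autonomous flows; the memory costs
exactly the factor `(1∓κ)^{∓1∕2}`, uniform in the scale. [folklore] -/
theorem enclosure {Λ : ℕ → ℝ} {K : ℕ} {βb p ε : ℝ}
    (hmono : ∀ u v : ℕ → ℝ, SeqBox γ u → SeqBox γ v → (∀ i, u i ≤ v i) → B u ≤ B v)
    (hB : ∀ u u' : ℕ → ℝ, SeqBox γ u → SeqBox γ u' → ∀ D : ℝ, (∀ j, |u j - u' j| ≤ D) → |B u - B u'| ≤ M * D) (hM : 0 ≤ M)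
    (hε : 0 ≤ ε) (hεb : ε < b) (hlow : ∀ u, SeqBox γ u → b ≤ B u) (hbdd : ∀ u, SeqBox γ u → B u ≤ βb)
    (hΛ : ∀ k, 0 ≤ Λ k) (hθ : ∑ k ∈ range K, (k : ℝ) * Λ k < 1)
    (hκ : (∑ k ∈ range K, (k : ℝ) * Λ k) * (2 * ε) / (1 - ∑ k ∈ range K, (k : ℝ) * Λ k) < b - ε)
    (hLip : ∀ u v : ℕ → ℝ, SeqBox γ u → SeqBox γ v → (∀ k : ℕ, 1 / γ ^ 2 + ((k : ℝ) + 1) * (b - ε) ≤ 1 / u k ^ 2) →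
      (∀ k : ℕ, 1 / γ ^ 2 + ((k : ℝ) + 1) * (b - ε) ≤ 1 / v k ^ 2) → B u - B v ≤ ∑ k ∈ range K, Λ k * max (1 / v k ^ 2 - 1 / u k ^ 2) 0)
    (hpert : ∀ u, SeqBox γ u → |B' u - B u| ≤ ε)
    (hp : 0 < p) (hpγ : p ≤ γ) (hhlo : SeqBox γ hlo) (hflo : MemFlow (fun w => B w + -ε) p hlo)
    (hhup : SeqBox γ hup) (hfup : MemFlow (fun w => B w + ε) p hup) (hh' : SeqBox γ h') (hf' : MemFlow B' p h') (j : ℕ) :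
    hup j / Real.sqrt (1 + (∑ k ∈ range K, (k : ℝ) * Λ k) * (2 * ε) / (1 - ∑ k ∈ range K, (k : ℝ) * Λ k) / (b - ε)) ≤ h' j
      ∧ h' j ≤ hlo j / Real.sqrt (1 - (∑ k ∈ range K, (k : ℝ) * Λ k) * (2 * ε) / (1 - ∑ k ∈ range K, (k : ℝ) * Λ k) / (b - ε)) :=
  ⟨enclosure_lower hmono hB hM hε hεb hlow hbdd hΛ hθ hLip hpert hp hpγ hhup hfup hh' hf' j,
    enclosure_upper hmono hB hM hεb hlow hbdd hΛ hθ hκ hLip hpert hp hpγ hhlo hflo hh' hf' j⟩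

end Summit.QuantumFields.BalabanUV.Beta.EriceRemainderEnclosureHistoryAutonomyComparisonDefectEnclosure

end
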